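import Mathlib.GroupTheory.OrderOfElement
import Mathlib.GroupTheory.SpecificGroups.Cyclic
import HarnessLib

/-!
# Route `GenusKolyvaginAtTwo`, crux L_T `PowDvdShaCardAtTwoRT` (stmt-BirchSwinnertonDyer-23242), LINE 18 stub KS, the DROPS:
# THE SOCLE COINCIDENCE AT `2` — every non-zero `2`-torsion eigenvector of an involution with cyclic fixed part is THE socle of the fixed part

Width seat `bsd-line-gk2-p4` g19 (cell `bsd-f1-sign2`), `--supports 23242 --as helper`.  THEOREMS ONLY (pure algebra, Mathlib only); no
`sorry`; standard axioms.  BSD is NOT proved by any of this; neither is the crux nor any stub.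

WHY (memo `Cruxes/PowDvdShaCardAtTwoRT/Lines/plus-descent-drops-klein.md`).  The drop engine of LINE 18 as planned (LEAD g15
`PlusDescent.swapOracle_of_twoPrimeReciprocity`) displays a Čebotarev input `hceb`: a new Kolyvagin prime `λ′` at which the two swap classes
`x = c_L(n/ℓ₀)`, `y = c_L(n)` (τ-eigenclasses of OPPOSITE signs) both have FULL local order AND a given `2`-torsion class `c` is detected.  At
such a `λ′` the local values live in the eigen-lines `(1 ± c₀)E[2^L]` of complex conjugation on `E[2^L] ≅ ℤ/2^L[C₂]` (route item Q1), and THIS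
FILE is the algebra showing that those two lines have THE SAME socle: for an involution `τ` of an additive group whose fixed part is cyclic
of order `2^L` (the shape of `CyclicFixedPartOfNegDisc`), every non-zero element killed by `2` that is `τ`-fixed OR `τ`-anti-fixed equals
`2^{L−1}•P` (`eq_socle_of_two_nsmul_eq_zero_of_eigen`; an anti-fixed `2`-torsion vector is fixed, `−u = u`).  Hence two such elements are
EQUAL and their sum VANISHES (`add_eq_zero_of_eigen_two_torsion`): the Klein residue `c* = b_x + b_y` (sum of the socles of `⟨x⟩`, `⟨y⟩`) is
invisible at every full-order prime, so `hceb` is not dischargeable when `c* ∈ C` — the geometric form of the LEAD's character-theoretic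
criterion `…RTKleinDetect.exists_addMonoidHom_fullOrder_pair_and_ne_zero_iff`.  At odd `p` the `±` lines meet in `0` (McCallum's «different
eigenspace» step); at `2` they share their socle.
* §1 `eq_socle_of_two_nsmul_eq_zero_of_mem_zmultiples` — in a cyclic group `⟨P⟩` of order `2^L`, a non-zero element killed by `2` is `2^{L−1}•P`;
* §2 **`eq_socle_of_two_nsmul_eq_zero_of_eigen`**, `eq_of_eigen_two_torsion`, **`add_eq_zero_of_eigen_two_torsion`**.
Namespace `…Theorems.GenusExact.PlusDescent`.  Closes nothing.  BSD is NOT proved by any of this.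

References: [McCallumLMS1991] §3 Prop. 3.1, §5 proof of Prop. 5.2 («since c is in a different eigenspace»); [GrossLMS1991] §3 (3.3), §9;
[Scorza1926] (Klein-four unions).
-/

set_option autoImplicit false
-- `Summit.<P>.<Sub>` repeats `BirchSwinnertonDyer` by the tree's layout convention (D-0017)
set_option linter.dupNamespace false

namespace Summit.BirchSwinnertonDyer.BirchSwinnertonDyer.Theorems.GenusExact.PlusDescent

section Socle

variable {M : Type*} [AddCommGroup M]

/-- **The socle of a cyclic `2`-group.**  If `addOrderOf P = 2^L` with `1 ≤ L`, then every NON-ZERO `u ∈ ⟨P⟩` with `2 • u = 0` is `2^{L−1} • P`.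
[folklore] -/
theorem eq_socle_of_two_nsmul_eq_zero_of_mem_zmultiples {P u : M} {L : ℕ} (hL : 1 ≤ L) (hP : addOrderOf P = 2 ^ L)
    (hu : u ∈ AddSubgroup.zmultiples P) (h2 : 2 • u = 0) (h0 : u ≠ 0) : u = 2 ^ (L - 1) • P := by
  obtain ⟨k, rfl⟩ := AddSubgroup.mem_zmultiples_iff.mp hu
  -- `2^L ∣ 2k`, so `2^{L-1} ∣ k`
  have hdvd : ((2 ^ L : ℕ) : ℤ) ∣ 2 * k := by
    rw [← hP, addOrderOf_dvd_iff_zsmul_eq_zero, ← smul_smul]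
    exact_mod_cast h2
  obtain ⟨L', rfl⟩ : ∃ L', L = L' + 1 := ⟨L - 1, by omega⟩
  rw [Nat.add_sub_cancel]
  have hdvd' : ((2 ^ L' : ℕ) : ℤ) ∣ k := by
    rw [pow_succ, Nat.cast_mul, Nat.cast_ofNat, mul_comm] at hdvd
    exact Int.dvd_of_mul_dvd_mul_left two_ne_zero hdvd
  obtain ⟨j, rfl⟩ := hdvd'
  -- `j` is odd, for otherwise `u = (j/2) • (2^L • P) = 0`
  rcases Int.even_or_odd j with ⟨i, rfl⟩ | ⟨i, rfl⟩
  · exfalso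
    apply h0
    have : ((2 ^ L' : ℕ) : ℤ) * (i + i) = i * ((2 ^ (L' + 1) : ℕ) : ℤ) := by push_cast; ring
    rw [this, mul_zsmul, ← hP, natCast_zsmul, addOrderOf_nsmul_eq_zero, zsmul_zero]
  · have : ((2 ^ L' : ℕ) : ℤ) * (2 * i + 1) = i * ((2 ^ (L' + 1) : ℕ) : ℤ) + ((2 ^ L' : ℕ) : ℤ) := by push_cast; ring
    rw [this, add_zsmul, mul_zsmul, ← hP, natCast_zsmul, natCast_zsmul, addOrderOf_nsmul_eq_zero, zsmul_zero, zero_add]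

/-! ## §2 Eigenvectors of an involution with cyclic fixed part -/

/-- **THE SOCLE COINCIDENCE AT `2`.**  Let `τ : M → M` be any map whose fixed set is the cyclic subgroup `⟨P⟩`, `addOrderOf P = 2^L`, `L ≥ 1`
(the shape of route item Q1 / `CyclicFixedPartOfNegDisc`: complex conjugation on `E[2^L]`, `Δ < 0`).  Then every NON-ZERO `u` with `2 • u = 0`
which is `τ`-fixed OR `τ`-ANTI-fixed (`τ u = −u`) equals `2^{L−1} • P`: an anti-fixed `2`-torsion vector is fixed (`−u = u`), and the fixed
`2`-torsion is the socle of `⟨P⟩`.  So the two eigen-lines `(1 ± τ)E[2^L]` have the same unique element of order `2`.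
[cite: McCallumLMS1991, §5 proof of Prop. 5.2 («since c is in a different eigenspace» — true at odd p only)] [cite: GrossLMS1991, §3 (3.3)] -/
theorem eq_socle_of_two_nsmul_eq_zero_of_eigen (τ : M → M) {P : M} {L : ℕ} (hL : 1 ≤ L) (hP : addOrderOf P = 2 ^ L)
    (hfix : ∀ Q : M, τ Q = Q ↔ Q ∈ AddSubgroup.zmultiples P) {u : M} (h2 : 2 • u = 0) (h0 : u ≠ 0)
    (heig : τ u = u ∨ τ u = -u) : u = 2 ^ (L - 1) • P := by
  have hneg : -u = u := by
    rw [neg_eq_iff_add_eq_zero, ← two_nsmul, h2]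
  have hfu : τ u = u := by
    rcases heig with h | h
    · exact h
    · rw [h, hneg]
  exact eq_socle_of_two_nsmul_eq_zero_of_mem_zmultiples hL hP ((hfix u).mp hfu) h2 h0

/-- **All non-zero `2`-torsion eigenvectors coincide** (either sign each). [cite: McCallumLMS1991, §5 proof of Prop. 5.2] -/
theorem eq_of_eigen_two_torsion (τ : M → M) {P : M} {L : ℕ} (hL : 1 ≤ L) (hP : addOrderOf P = 2 ^ L)
    (hfix : ∀ Q : M, τ Q = Q ↔ Q ∈ AddSubgroup.zmultiples P) {u v : M} (hu2 : 2 • u = 0) (hu0 : u ≠ 0)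
    (hu : τ u = u ∨ τ u = -u) (hv2 : 2 • v = 0) (hv0 : v ≠ 0) (hv : τ v = v ∨ τ v = -v) : u = v := by
  rw [eq_socle_of_two_nsmul_eq_zero_of_eigen τ hL hP hfix hu2 hu0 hu, eq_socle_of_two_nsmul_eq_zero_of_eigen τ hL hP hfix hv2 hv0 hv]

/-- **The Klein residue is invisible**: the SUM of two non-zero `2`-torsion eigenvectors (any signs) is ZERO.  Applied to the local values at a
Kolyvagin prime of full local order for two swap classes of opposite signs: `loc(b_x) + loc(b_y) = 0`, i.e. the class `b_x + b_y` is locally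
trivial there — the `hceb` clause of `swapOracle_of_twoPrimeReciprocity` cannot detect it. [cite: McCallumLMS1991, §5 proof of Prop. 5.2] -/
theorem add_eq_zero_of_eigen_two_torsion (τ : M → M) {P : M} {L : ℕ} (hL : 1 ≤ L) (hP : addOrderOf P = 2 ^ L)
    (hfix : ∀ Q : M, τ Q = Q ↔ Q ∈ AddSubgroup.zmultiples P) {u v : M} (hu2 : 2 • u = 0) (hu0 : u ≠ 0)
    (hu : τ u = u ∨ τ u = -u) (hv2 : 2 • v = 0) (hv0 : v ≠ 0) (hv : τ v = v ∨ τ v = -v) : u + v = 0 := by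
  rw [eq_of_eigen_two_torsion τ hL hP hfix hu2 hu0 hu hv2 hv0 hv, ← two_nsmul, hv2]

/-- The same with the possibly-zero cases folded in: for `2`-torsion eigenvectors `u`, `v` (any signs), `u + v = 0` unless exactly one of them is
zero. [folklore] -/
theorem add_eq_zero_of_eigen_two_torsion_iff (τ : M → M) {P : M} {L : ℕ} (hL : 1 ≤ L) (hP : addOrderOf P = 2 ^ L)
    (hfix : ∀ Q : M, τ Q = Q ↔ Q ∈ AddSubgroup.zmultiples P) {u v : M} (hu2 : 2 • u = 0) (hu : τ u = u ∨ τ u = -u) (hv2 : 2 • v = 0)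
    (hv : τ v = v ∨ τ v = -v) : u + v = 0 ↔ (u = 0 ↔ v = 0) := by
  constructor
  · intro h
    rw [add_eq_zero_iff_eq_neg] at h
    subst h
    simp
  · intro h
    by_cases hu0 : u = 0
    · rw [hu0, h.mp hu0, add_zero]
    · exact add_eq_zero_of_eigen_two_torsion τ hL hP hfix hu2 hu0 hu hv2 (fun hv0 ↦ hu0 (h.mpr hv0)) hv

end Socle

end Summit.BirchSwinnertonDyer.BirchSwinnertonDyer.Theorems.GenusExact.PlusDescent
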